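import Literature.AlgebraicGeometry.Frobenioids.Cor54RigidityLinearReduction
import HarnessLib

/-!
# Frobenioids I, Corollary 5.4 (strong 1-uniqueness at THE data): translation of identity-base linear
# morphisms along image pre-steps (sub-DAG row C54-core-arith, sub-row (4), file 4b-I)

Mochizuki, *The geometry of Frobenioids I: the general theory*, Kyushu J. Math. **62** (2008) 293–400,
Corollary 5.4, kurims p. 104 ll. 1–9; model Frobenioids Thm. 5.2 (i) p. 100; Prop. 5.3 p. 103.
[cite: MochizukiFrdI2008, Cor. 5.4 p.104] [cite: MochizukiFrdI2008, Thm. 5.2(i) p.100]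

PROOF-ONLY file (cell abc-iut, seat abc-iut-L1-d8; sub-row (4) of row C54-core-arith; no definitions),
continuing `Cor54RigidityLinearReduction.lean`: there, hom-rigidity of the image of the functor of model
Frobenioids `G = h.functor` induced by a morphism of model data `h : (Φ, B, Div_B) → (Φ', B', Div_B')` (e.g.
`G = untrToRlf : C^un-tr → C^rlf`) was reduced to the identity-base linear morphisms
`k = (1, 𝟙_A, z, u) : G(A, γ) → G(A, γ')`. This file records the GENERIC (model-level) identities that pin a
functorial self-map `ρ` of the image homs (fixing the `G f`) on such `k`:

* `exists_translate` — for an effective divisor `w ∈ Φ(A)` of the SOURCE monoid, the image pre-steps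
  `Z_w = G(1, 𝟙_A, w, 0)` intertwine `k` with its TRANSLATE `k_w = (1, 𝟙_A, z, u) : G(A, γ + w) → G(A, γ' + w)`:
  `G(Z_w) ≫ k_w = k ≫ G(Z'_w)`;
* `rho_translate` — comparing
  `ρ(k_w)` with `ρ(k) =: (d̂, σ̂, ẑ, û)`: same degree, base and unit coordinate, and
  `Div(ρ k_w) + d̂ · η(w) = Φ'(σ̂)(η(w)) + ẑ` in the (effective!) monoid `Φ'(A)` — the identity from which,
  at the arithmetic Frobenioid, effectivity forces `d̂ = 1` and `σ̂ = 𝟙` (file 4b-II);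
* `rho_translate_of_linear` — once `d̂ = 1` and `σ̂ = 𝟙`: `Div(ρ k_w) = Div(ρ k)` (translation invariance).

Pure model-Frobenioid algebra; nothing here bears on [IUTchIII] Cor. 3.12.
-/

noncomputable section

namespace Literature.AlgebraicGeometry.Frobenioids

open CategoryTheory Opposite

universe w v u

namespace ModelFrobenioid.DataHom

variable {D : Type u} [Category.{v} D] {Φ B Φ' B' : Dᵒᵖ ⥤ CommMonCat.{w}} {DivB : B ⟶ monoidGp Φ}
  {DivB' : B' ⟶ monoidGp Φ'} (h : DataHom DivB DivB')

/-- **Translation along image pre-steps.** Let `k : G(A, γ) → G(A, γ')` have `deg_Fr(k) = 1` and `Base(k) = 𝟙_A`,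
and let `w ∈ Φ(A)`. With the pre-steps `Z_w = (1, 𝟙_A, w, 0) : (A, γ) → (A, γ + w)` and
`Z'_w = (1, 𝟙_A, w, 0) : (A, γ') → (A, γ' + w)` of the source model, the morphism
`k_w := (1, 𝟙_A, Div k, u_k) : G(A, γ + w) → G(A, γ' + w)` satisfies `G(Z_w) ≫ k_w = k ≫ G(Z'_w)`.
[cite: MochizukiFrdI2008, Thm. 5.2(i) p.100] -/
theorem exists_translate (A : D) (γ γ' : Algebra.GrothendieckGroup (Φ.obj (op A)))
    (k : h.functor.obj ⟨A, γ⟩ ⟶ h.functor.obj ⟨A, γ'⟩) (hd : degFr k = 1) (hb : baseMap k = 𝟙 A)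
    (w : Φ.obj (op A)) :
    ∃ (Z : (⟨A, γ⟩ : ModelFrobenioid Φ B DivB) ⟶ ⟨A, γ * Algebra.GrothendieckGroup.of w⟩)
      (Z' : (⟨A, γ'⟩ : ModelFrobenioid Φ B DivB) ⟶ ⟨A, γ' * Algebra.GrothendieckGroup.of w⟩)
      (kw : h.functor.obj ⟨A, γ * Algebra.GrothendieckGroup.of w⟩ ⟶
        h.functor.obj ⟨A, γ' * Algebra.GrothendieckGroup.of w⟩),
      degFr Z = 1 ∧ baseMap Z = 𝟙 A ∧ div Z = w ∧ unit Z = 1 ∧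
      degFr Z' = 1 ∧ baseMap Z' = 𝟙 A ∧ div Z' = w ∧ unit Z' = 1 ∧
      degFr kw = 1 ∧ baseMap kw = 𝟙 A ∧
      (h.η.app (op A)).hom (div Z) = (h.η.app (op A)).hom w ∧
      div kw = (show Φ'.obj (op A) from div k) ∧ unit kw = (show B'.obj (op A) from unit k) ∧
      h.functor.map Z ≫ kw = k ≫ h.functor.map Z' := by
  obtain ⟨d, f, z, uu, hrel⟩ := k
  change ℕ+ at d
  change A ⟶ A at f
  change ↥(Φ'.obj (op A)) at z
  change ↥(B'.obj (op A)) at uu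
  change d = 1 at hd
  change f = 𝟙 A at hb
  subst hd
  subst hb
  have hr : (gpApp h.η (op A) γ) ^ ((1 : ℕ+) : ℕ) * Algebra.GrothendieckGroup.of z =
      pullGp Φ' (𝟙 A) (gpApp h.η (op A) γ') * divB Φ' B' DivB' (op A) uu := hrel
  rw [PNat.one_coe, pow_one, pullGp_id] at hr
  refine ⟨⟨1, 𝟙 A, w, 1, ?_⟩, ⟨1, 𝟙 A, w, 1, ?_⟩, ⟨1, 𝟙 A, z, uu, ?_⟩,
    rfl, rfl, rfl, rfl, rfl, rfl, rfl, rfl, rfl, rfl, rfl, rfl, rfl, ?_⟩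
  · rw [PNat.one_coe, pow_one, map_one, mul_one, pullGp_id]
  · rw [PNat.one_coe, pow_one, map_one, mul_one, pullGp_id]
  · show (gpApp h.η (op A) (γ * Algebra.GrothendieckGroup.of w)) ^ ((1 : ℕ+) : ℕ) *
        Algebra.GrothendieckGroup.of z =
      pullGp Φ' (𝟙 A) (gpApp h.η (op A) (γ' * Algebra.GrothendieckGroup.of w)) * divB Φ' B' DivB' (op A) uu
    rw [PNat.one_coe, pow_one, pullGp_id, map_mul, map_mul, mul_right_comm, hr, mul_right_comm]
  · apply hom_ext
    · rfl
    · rfl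
    · show (Φ'.map (𝟙 A).op).hom z * (h.η.app (op A)).hom w ^ ((1 : ℕ+) : ℕ) =
        (Φ'.map (𝟙 A).op).hom ((h.η.app (op A)).hom w) * z ^ ((1 : ℕ+) : ℕ)
      rw [op_id, Φ'.map_id, CommMonCat.hom_id, MonoidHom.id_apply, MonoidHom.id_apply, PNat.one_coe, pow_one,
        pow_one, mul_comm]
    · show (B'.map (𝟙 A).op).hom uu * (h.β.app (op A)).hom 1 ^ ((1 : ℕ+) : ℕ) =
        (B'.map (𝟙 A).op).hom ((h.β.app (op A)).hom 1) * uu ^ ((1 : ℕ+) : ℕ)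
      rw [op_id, B'.map_id, CommMonCat.hom_id, MonoidHom.id_apply, MonoidHom.id_apply, PNat.one_coe, pow_one,
        pow_one, map_one, mul_one, one_mul]

/-- **`ρ` on translates.** For `ρ` functorial on the image homs and fixing the `G f`, an identity-base linear
`k = (1, 𝟙_A, z, u) : G(A, γ) → G(A, γ')`, `w ∈ Φ(A)` and the translate `k_w = (1, 𝟙_A, z, u) : G(A, γ + w) →
G(A, γ' + w)`, write `ρ(k) = (d̂, σ̂, ẑ, û)`. Then `ρ(k_w) = (d̂, σ̂, ẑ_w, û)` with
`ẑ_w · η(w)^{d̂} = Φ'(σ̂)(η(w)) · ẑ` in `Φ'(A)` (apply `ρ` to `G(Z_w) ≫ k_w = k ≫ G(Z'_w)` and read off the four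
components of Thm. 5.2 (i)). [cite: MochizukiFrdI2008, Thm. 5.2(i) p.100] -/
theorem rho_translate
    (ρ : ∀ ⦃a a' : ModelFrobenioid Φ B DivB⦄,
      (h.functor.obj a ⟶ h.functor.obj a') → (h.functor.obj a ⟶ h.functor.obj a'))
    (hcomp : ∀ ⦃a a' a'' : ModelFrobenioid Φ B DivB⦄ (k : h.functor.obj a ⟶ h.functor.obj a')
      (l : h.functor.obj a' ⟶ h.functor.obj a''), ρ (k ≫ l) = ρ k ≫ ρ l)
    (hmap : ∀ ⦃a a' : ModelFrobenioid Φ B DivB⦄ (f : a ⟶ a'), ρ (h.functor.map f) = h.functor.map f)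
    (A : D) (γ γ' : Algebra.GrothendieckGroup (Φ.obj (op A)))
    (k : h.functor.obj ⟨A, γ⟩ ⟶ h.functor.obj ⟨A, γ'⟩) (hd : degFr k = 1) (hb : baseMap k = 𝟙 A)
    (z : Φ'.obj (op A)) (uu : B'.obj (op A)) (hz : div k = z) (hu : unit k = uu)
    (d' : ℕ+) (σ' : A ⟶ A) (z' : Φ'.obj (op A)) (u' : B'.obj (op A))
    (hρd : degFr (ρ k) = d') (hρb : baseMap (ρ k) = σ') (hρz : div (ρ k) = z') (hρu : unit (ρ k) = u')
    (w : Φ.obj (op A)) :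
    ∃ (kw : h.functor.obj ⟨A, γ * Algebra.GrothendieckGroup.of w⟩ ⟶
        h.functor.obj ⟨A, γ' * Algebra.GrothendieckGroup.of w⟩) (zw' : Φ'.obj (op A)),
      degFr kw = 1 ∧ baseMap kw = 𝟙 A ∧ div kw = z ∧ unit kw = uu ∧
      degFr (ρ kw) = d' ∧ baseMap (ρ kw) = σ' ∧ div (ρ kw) = zw' ∧ unit (ρ kw) = u' ∧
      zw' * (h.η.app (op A)).hom w ^ (d' : ℕ) = (Φ'.map σ'.op).hom ((h.η.app (op A)).hom w) * z' := by
  -- components of `k`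
  obtain ⟨d, f, z₁, u₁, hrel⟩ := k
  change ℕ+ at d
  change A ⟶ A at f
  change ↥(Φ'.obj (op A)) at z₁
  change ↥(B'.obj (op A)) at u₁
  change d = 1 at hd
  change f = 𝟙 A at hb
  change z₁ = z at hz
  change u₁ = uu at hu
  subst hd hb hz hu
  have hr : (gpApp h.η (op A) γ) ^ ((1 : ℕ+) : ℕ) * Algebra.GrothendieckGroup.of z₁ =
      pullGp Φ' (𝟙 A) (gpApp h.η (op A) γ') * divB Φ' B' DivB' (op A) u₁ := hrel
  rw [PNat.one_coe, pow_one, pullGp_id] at hr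
  -- the pre-steps `Z_w`, `Z'_w` of the source model and the translate `k_w`
  let Z : (⟨A, γ⟩ : ModelFrobenioid Φ B DivB) ⟶ ⟨A, γ * Algebra.GrothendieckGroup.of w⟩ :=
    ⟨1, 𝟙 A, w, 1, by rw [PNat.one_coe, pow_one, map_one, mul_one, pullGp_id]⟩
  let Z' : (⟨A, γ'⟩ : ModelFrobenioid Φ B DivB) ⟶ ⟨A, γ' * Algebra.GrothendieckGroup.of w⟩ :=
    ⟨1, 𝟙 A, w, 1, by rw [PNat.one_coe, pow_one, map_one, mul_one, pullGp_id]⟩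
  let kw : h.functor.obj ⟨A, γ * Algebra.GrothendieckGroup.of w⟩ ⟶
      h.functor.obj ⟨A, γ' * Algebra.GrothendieckGroup.of w⟩ :=
    ⟨1, 𝟙 A, z₁, u₁, by
      show (gpApp h.η (op A) (γ * Algebra.GrothendieckGroup.of w)) ^ ((1 : ℕ+) : ℕ) *
          Algebra.GrothendieckGroup.of z₁ =
        pullGp Φ' (𝟙 A) (gpApp h.η (op A) (γ' * Algebra.GrothendieckGroup.of w)) * divB Φ' B' DivB' (op A) u₁
      rw [PNat.one_coe, pow_one, pullGp_id, map_mul, map_mul, mul_right_comm, hr, mul_right_comm]⟩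
  set k₀ : h.functor.obj ⟨A, γ⟩ ⟶ h.functor.obj ⟨A, γ'⟩ :=
    (⟨1, 𝟙 A, z₁, u₁, hrel⟩ : h.functor.obj ⟨A, γ⟩ ⟶ h.functor.obj ⟨A, γ'⟩) with hk₀
  have hsq : h.functor.map Z ≫ kw = k₀ ≫ h.functor.map Z' := by
    apply hom_ext
    · rfl
    · rfl
    · show (Φ'.map (𝟙 A).op).hom z₁ * (h.η.app (op A)).hom w ^ ((1 : ℕ+) : ℕ) =
        (Φ'.map (𝟙 A).op).hom ((h.η.app (op A)).hom w) * z₁ ^ ((1 : ℕ+) : ℕ)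
      rw [op_id, Φ'.map_id, CommMonCat.hom_id, MonoidHom.id_apply, MonoidHom.id_apply, PNat.one_coe, pow_one,
        pow_one, mul_comm]
    · show (B'.map (𝟙 A).op).hom u₁ * (h.β.app (op A)).hom 1 ^ ((1 : ℕ+) : ℕ) =
        (B'.map (𝟙 A).op).hom ((h.β.app (op A)).hom 1) * u₁ ^ ((1 : ℕ+) : ℕ)
      rw [op_id, B'.map_id, CommMonCat.hom_id, MonoidHom.id_apply, MonoidHom.id_apply, PNat.one_coe, pow_one,
        pow_one, map_one, mul_one, one_mul]
  have hρ : h.functor.map Z ≫ ρ kw = ρ k₀ ≫ h.functor.map Z' := by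
    rw [← hmap Z, ← hcomp, hsq, hcomp, hmap]
  -- components of `ρ k` and `ρ k_w`
  generalize hρk : ρ k₀ = rk at hρ hρd hρb hρz hρu
  obtain ⟨d₀, σ₀, z₀, u₀, hr₀⟩ := rk
  change ℕ+ at d₀
  change A ⟶ A at σ₀
  change ↥(Φ'.obj (op A)) at z₀
  change ↥(B'.obj (op A)) at u₀
  change d₀ = d' at hρd
  change σ₀ = σ' at hρb
  change z₀ = z' at hρz
  change u₀ = u' at hρu
  subst hρd hρb hρz hρu
  generalize hρkw : ρ kw = rkw at hρ
  obtain ⟨dw, σw, zw, uw, hrw⟩ := rkw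
  change ℕ+ at dw
  change A ⟶ A at σw
  change ↥(Φ'.obj (op A)) at zw
  change ↥(B'.obj (op A)) at uw
  refine ⟨kw, zw, rfl, rfl, rfl, rfl, ?_⟩
  rw [hρkw]
  -- the four components of `hρ`
  have h1 : dw * 1 = 1 * d₀ := congrArg degFr hρ
  have h2 : 𝟙 A ≫ σw = σ₀ ≫ 𝟙 A := congrArg baseMap hρ
  have h3 : (Φ'.map (𝟙 A).op).hom zw * (h.η.app (op A)).hom w ^ (dw : ℕ) =
      (Φ'.map σ₀.op).hom ((h.η.app (op A)).hom w) * z₀ ^ ((1 : ℕ+) : ℕ) := congrArg div hρ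
  have h4 : (B'.map (𝟙 A).op).hom uw * (h.β.app (op A)).hom 1 ^ (dw : ℕ) =
      (B'.map σ₀.op).hom ((h.β.app (op A)).hom 1) * u₀ ^ ((1 : ℕ+) : ℕ) := congrArg unit hρ
  rw [mul_one, one_mul] at h1
  rw [Category.id_comp, Category.comp_id] at h2
  rw [PNat.one_coe, pow_one, op_id, Φ'.map_id, CommMonCat.hom_id, MonoidHom.id_apply, h1] at h3
  rw [PNat.one_coe, pow_one, op_id, B'.map_id, CommMonCat.hom_id, MonoidHom.id_apply, map_one, map_one,
    one_pow, mul_one, one_mul] at h4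
  exact ⟨h1, h2, rfl, h4, h3⟩

/-- **Translation invariance of the zero divisor** once `ρ(k)` is known to be identity-base linear
(`d̂ = 1`, `σ̂ = 𝟙_A`) and `Φ'(A)` is right-cancellative (e.g. divisorial): `ρ(k_w) = (1, 𝟙_A, ẑ, û)` for every
`w ∈ Φ(A)`. [cite: MochizukiFrdI2008, Thm. 5.2(i) p.100] -/
theorem rho_translate_of_linear (A : D) [IsRightCancelMul (Φ'.obj (op A))]
    (ρ : ∀ ⦃a a' : ModelFrobenioid Φ B DivB⦄,
      (h.functor.obj a ⟶ h.functor.obj a') → (h.functor.obj a ⟶ h.functor.obj a'))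
    (hcomp : ∀ ⦃a a' a'' : ModelFrobenioid Φ B DivB⦄ (k : h.functor.obj a ⟶ h.functor.obj a')
      (l : h.functor.obj a' ⟶ h.functor.obj a''), ρ (k ≫ l) = ρ k ≫ ρ l)
    (hmap : ∀ ⦃a a' : ModelFrobenioid Φ B DivB⦄ (f : a ⟶ a'), ρ (h.functor.map f) = h.functor.map f)
    (γ γ' : Algebra.GrothendieckGroup (Φ.obj (op A)))
    (k : h.functor.obj ⟨A, γ⟩ ⟶ h.functor.obj ⟨A, γ'⟩) (hd : degFr k = 1) (hb : baseMap k = 𝟙 A)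
    (z : Φ'.obj (op A)) (uu : B'.obj (op A)) (hz : div k = z) (hu : unit k = uu)
    (z' : Φ'.obj (op A)) (u' : B'.obj (op A))
    (hρd : degFr (ρ k) = 1) (hρb : baseMap (ρ k) = 𝟙 A) (hρz : div (ρ k) = z') (hρu : unit (ρ k) = u')
    (w : Φ.obj (op A)) :
    ∃ (kw : h.functor.obj ⟨A, γ * Algebra.GrothendieckGroup.of w⟩ ⟶
        h.functor.obj ⟨A, γ' * Algebra.GrothendieckGroup.of w⟩),
      degFr kw = 1 ∧ baseMap kw = 𝟙 A ∧ div kw = z ∧ unit kw = uu ∧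
      degFr (ρ kw) = 1 ∧ baseMap (ρ kw) = 𝟙 A ∧ div (ρ kw) = z' ∧ unit (ρ kw) = u' := by
  obtain ⟨kw, zw', hkwd, hkwb, hkwz, hkwu, h1, h2, h3, h4, h5⟩ :=
    h.rho_translate ρ hcomp hmap A γ γ' k hd hb z uu hz hu 1 (𝟙 A) z' u' hρd hρb hρz hρu w
  refine ⟨kw, hkwd, hkwb, hkwz, hkwu, h1, h2, ?_, h4⟩
  rw [PNat.one_coe, pow_one, op_id, Φ'.map_id, CommMonCat.hom_id, MonoidHom.id_apply, mul_comm _ z'] at h5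
  have h6 : zw' = z' := mul_right_cancel h5
  rw [h3]
  exact h6

end ModelFrobenioid.DataHom

end Literature.AlgebraicGeometry.Frobenioids
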